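import Summits.QuantumFields.YangMills.Theses.F4SubCurvatureDoor

/-!
# Route F4SubCurvatureDoor — the glue `ShortRootRigidityGlue` (stmt-QuantumFields-23126), proved

`RationalShortRootRigidity → RationalToGeneral → ShortRootRigidity` with `RationalToGeneral :=
RationalShortRootRigidity → ShortRootRigidity`: modus ponens.  Pure logic; both children (stmt-23124, stmt-23125)
remain hypotheses of the route — no crux, rung or summit is proved here. [folklore]
-/

namespace Summit.QuantumFields.YangMills.Theorems

open Summit.QuantumFields.YangMills.Theses.F4SubCurvatureDoor

/-- The glue `ShortRootRigidityGlue` holds: `fun a b => b a`. [folklore] -/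
theorem f4SubCurvatureDoor_shortRootRigidityGlue_proof :
    Summit.QuantumFields.YangMills.Theses.F4SubCurvatureDoor.ShortRootRigidityGlue :=
  fun a b => b a

end Summit.QuantumFields.YangMills.Theorems
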